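import Summits.QuantumFields.YangMills.Theses.PencilRigidity

/-!
# `DiagonalMirrorRPR` — negative lemma: the statement's own (square periodic) tori are not swap-RP

Supports crux item `stmt-QuantumFields-10604` (`PencilRigidity.DiagonalMirrorRPR` =
`MirrorModularBoosts.DiagonalMirrorRPR`). The intended proof of the crux needs reflection positivity of
Wilson's measure across the DIAGONAL mirror `x₀ = x₁`; on free swap-symmetric boxes and 45°-tilted tori this
is the FILS cone argument, but the crux's lattice data live on square periodic tori of odd side `2L_k + 1`
(`SpeciesScheme.side`). This file records, as checked theorems, why no square periodic torus (of either
parity) carries a swap-RP structure: the swap `(x,y) ↦ (y,x)` of `(ℤ/S)²` fixes only the diagonal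
(`swap_fixed_iff`); on an odd torus the far cut lies between the layers `u = L` and `u = L+1`, which the swap
exchanges (`oddTorus_far_layers_swapped`); on an even torus the far line `u = L` is mapped to itself by a
fixed-point-free glide (`evenTorus_far_line_glide`); and an exact certificate: the `3 × 3` nearest-neighbour
Ising torus (equivalently ℤ₂ lattice gauge theory on the `3×3×1` torus through its gauge-invariant Polyakov
spins) has a NEGATIVE swap pairing `∑_σ w(σ)F(σ)F(θσ) = −67184640` for `F = 2σ(1,0) − σ(2,1) − σ(0,2)`
supported in the positive half (`Ising3.ising3_swap_pairing_neg`, by `decide`). Consequence for the route: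
the transport of diagonal RP to the statement's tori (TorusFreeInsensitivity) is load-bearing.
[FILS II = Fröhlich–Israel–Lieb–Simon, J. Stat. Phys. 22 (1980), §3.]
-/

namespace Summit.QuantumFields.YangMills.Theorems.DiagonalMirrorRPR.Negative


section SquareTori

/-- On the square torus `(ℤ/S)²` the swap `(x, y) ↦ (y, x)` fixes exactly the diagonal. [folklore] -/
theorem swap_fixed_iff {S : ℕ} (x y : ZMod S) : ((y, x) : ZMod S × ZMod S) = (x, y) ↔ x = y := by
  constructor
  · intro h; exact (Prod.mk.inj h).2
  · rintro rfl; rfl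

/-- **Odd torus: the far cut is between the layers `u = L` and `u = L + 1`, which the swap EXCHANGES**
(`u = x − y`; on `ℤ/(2L+1)`, `−L = L + 1`): no second mirror of sites, the would-be mirror `u = L + ½`
cuts the `(0,1)`-plaquettes through a corner, and its crossing links wind around the torus. [folklore] -/
theorem oddTorus_far_layers_swapped (L : ℕ) (x y : ZMod (2 * L + 1)) (h : x - y = L) :
    y - x = L + 1 := by
  have h2 : ((2 * L + 1 : ℕ) : ZMod (2 * L + 1)) = 0 := ZMod.natCast_self _
  push_cast at h2
  linear_combination (-1 : ZMod (2 * L + 1)) * h - h2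

/-- **Even torus: the far line `u = L` is mapped to itself by the swap, but as the GLIDE `(x, y) ↦
(x + L, y + L)`** (no fixed site for `L ≠ 0`): square tori of either parity have ONE genuine swap mirror,
so the FILS cone argument is unavailable on them (the swap-RP cut-offs are the 45°-tilted tori
`ℤ²/⟨(M,M),(N,−N)⟩` and free swap-symmetric boxes, FILS II §3). [folklore] -/
theorem evenTorus_far_line_glide (L : ℕ) (x y : ZMod (2 * L)) (h : x - y = L) :
    ((y, x) : ZMod (2 * L) × ZMod (2 * L)) = (x + L, y + L) := by
  have h2 : ((2 * L : ℕ) : ZMod (2 * L)) = 0 := ZMod.natCast_self _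
  push_cast at h2
  refine Prod.ext ?_ ?_
  · show y = x + L
    linear_combination (-1 : ZMod (2 * L)) * h - h2
  · show x = y + L
    linear_combination h

end SquareTori

/-! ### Exact certificate on the `3 × 3` torus

Nearest-neighbour Ising model on `(ℤ/3)²` with bond weights `2 + σσ'` (i.e. `e^{βσσ'}` up to a constant,
`tanh β = 1/2`), swap `θ(x,y) = (y,x)`, positive half `Λ₊ = {u = x − y = 1}`, negative half `Λ₋ = {u = 2}`,
mirror `{u = 0}`. The real observable `F = 2σ(1,0) − σ(2,1) − σ(0,2)` is supported in `Λ₊`, `θF = F ∘ θ` in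
`Λ₋`, and `∑_σ w(σ) F(σ) (θF)(σ) = −67184640 < 0`: the torus Gibbs state is NOT reflection positive for the
swap (whereas it is RP for the axis reflections, FILS I). GAUGE READING: on the `3×3×1` torus the ℤ₂ lattice
gauge theory with Wilson weight `∏ₚ(2 + U_p)` factorises into the planar gauge field and an Ising model in the
gauge-invariant Polyakov spins `V_x = U_{(x,e₂)}` (the `(0,2)`/`(1,2)` plaquettes are `V_x V_{x+e₀}`,
`V_x V_{x+e₁}` since `x + e₂ = x`), so the same number, times the positive planar partition function, is the
swap pairing of the Polyakov-loop observable `2V(1,0) − V(2,1) − V(0,2)` in a genuine lattice gauge theory.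
(The `4 × 4` torus fails too: weights `5 + σσ'`, `F = σ(1,0)σ(2,1) − σ(1,0)σ(0,3) − σ(2,1)σ(3,2)
+ σ(3,2)σ(0,3)` at level `u = 1`, pairing `−32605077635079717519360000`, brute force outside Lean.)
-/

namespace Ising3

/-- Bit index of the site `(x mod 3, y mod 3)`. [folklore] -/
def idx (x y : ℕ) : ℕ := 3 * (x % 3) + y % 3

/-- Spin of configuration `c < 2⁹` at `(x, y)`. [folklore] -/
def spin (c : ℕ) (x y : ℕ) : ℤ := if Nat.testBit c (idx x y) then 1 else -1

/-- Gibbs weight `∏_{⟨ss'⟩} (2 + σ_s σ_{s'})` over the 18 nearest-neighbour bonds of the `3×3` torus. [folklore] -/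
def weight (c : ℕ) : ℤ :=
  (((List.range 3).map fun x => ((List.range 3).map fun y =>
      (2 + spin c x y * spin c (x + 1) y) * (2 + spin c x y * spin c x (y + 1))).prod)).prod

/-- `F = 2σ(1,0) − σ(2,1) − σ(0,2)`, supported on the layer `u = x − y = 1`. [folklore] -/
def F (c : ℕ) : ℤ := 2 * spin c 1 0 - spin c 2 1 - spin c 0 2

/-- `θF = F ∘ swap = 2σ(0,1) − σ(1,2) − σ(2,0)`, supported on `u = 2`. [folklore] -/
def Fθ (c : ℕ) : ℤ := 2 * spin c 0 1 - spin c 1 2 - spin c 2 0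

/-- The swap pairing `∑_σ w(σ) F(σ) θF(σ)` (unnormalised). [folklore] -/
def pairing : ℤ := ((List.range 512).map fun c => weight c * F c * Fθ c).sum

/-- The exact value. [folklore] -/
theorem pairing_eq : pairing = -67184640 := by decide +kernel

/-- **The `3 × 3` Ising torus (equivalently ℤ₂ gauge theory on the `3×3×1` torus through its Polyakov spins) is
not swap-reflection-positive.** [folklore] -/
theorem ising3_swap_pairing_neg : pairing < 0 := by rw [pairing_eq]; decide

end Ising3


end Summit.QuantumFields.YangMills.Theorems.DiagonalMirrorRPR.Negative
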